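import Summits.AtomisticToContinuum.HydrodynamicLimit.Theorems.BoxDissipativeWeakStrongFluxClosureEqHomogeneousPrelim
import Summits.AtomisticToContinuum.HydrodynamicLimit.Theorems.BoxDissipativeWeakStrongFluxClosureEqHomFineScale
import Summits.AtomisticToContinuum.HydrodynamicLimit.Theorems.BoxDissipativeWeakStrongFluxClosureEqLimitDefect
import Summits.AtomisticToContinuum.HydrodynamicLimit.Theorems.BoxDissipativeWeakStrongFluxClosureEqHomLinear
import Summits.AtomisticToContinuum.HydrodynamicLimit.Theorems.BoxDissipativeWeakStrongFluxClosureEqHomConvective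
import Summits.AtomisticToContinuum.HydrodynamicLimit.Theorems.BoxDissipativeWeakStrongFluxClosureEqHomPressure
import Summits.AtomisticToContinuum.HydrodynamicLimit.Theorems.CollisionIsometryCLTCollisionalTransferLocalityCompressibilityContinuous
import HarnessLib

/-!
# Crux `FluxClosure` in global equilibrium (rung 0) — route `BoxDissipativeWeakStrong`,
item stmt-AtomisticToContinuum-9902, line `registered`, registered sub-goal E8 `fluxClosure_homogeneous`

Support file of the lead prover. The crux
`Summit.AtomisticToContinuum.HydrodynamicLimit.Theses.BoxDissipativeWeakStrong.FluxClosure` asserts that the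
pathwise box momentum-balance DEFECT of `N + 1` deterministic hard spheres at fixed reduced density,
`D_N(z) = [∫⟪m̂, w⟫]_0^τ − ∫_{(0,τ]} ∫ (⟪m̂, ∂ₜw⟫ + Σᵢⱼ (m̂ᵢm̂ⱼ/ρ̂) ∂ⱼwᵢ + p_cut(ρ̂, θ̂) div w) dx dt`
(box fields at a kinetic window `ℓ_N → 0`, `(N+1)ℓ_N³ → ∞`; cut hard-sphere pressure
`p_cut = ρ̂θ̂ Z(min(ρ̂σ³, η₁))`), tends to `0` in `L¹(P_N)` along EVERY hard-sphere flow, for local Gibbs initial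
laws with arbitrary continuous profiles — whose positive-time content (flux-level local equilibrium) is open.

`fluxClosure_homogeneous` proves the crux's conclusion for CONSTANT profiles `a₀ ≡ a`, `u₀ ≡ u`, `θ₀ ≡ θ`
(GLOBAL EQUILIBRIUM: the homogeneous Gibbs law, stationary under the dynamics), in the crux's own frame
(`HsEosLowDensity → ∃ η_c ∀ η₁ < η_c ∀ a θ u ∃ σ₀ ∀ σ < σ₀ ∀ T Φ ∀ kinetic windows ∀ τ < T ∀ smooth w`), for every
flow family and every kinetic window. It assembles the five registered rung-0 pieces landed by the lead's
workers: the homogeneous fine-scale law of large numbers at all times (`E1.homogeneous_fineScale_allTimes`: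
cluster-expansion statics `LGFS.statics_kernel` + stationarity `map_flow_localGibbsLaw_const`), the vanishing of
the defect at constant fields (`E2.homogeneous_limitDefect_eq_zero`: torus calculus), and the `L¹(P_N)`
convergence of the linear (`E3`), convective (`E4`) and cut-pressure (`E5`) pieces to their constant-field values;
plus `Z` continuous near `0` (`hsCompressibility_continuousOn`). The assembly is: `P_N`-a.e. datum is good; along a
good orbit the interior integral splits into its three pieces (`E8_orbit_integrable`), and so does the constant-field
one; subtract `E2`; `L¹(P_N)` triangle inequality for `∫⁻` (a.e.-measurability of four of the five terms,
`E8_aemeasurable_tsIntegral`); sum of five null sequences.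

This is the first positive-time, kernel-checked instance of the crux: a calibration of its 3.9 k-character defect
functional along the real deterministic dynamics (time orientation, boundary terms, kinetic window scaling, the
junk conventions of empty boxes, the cut), in the one regime where local equilibrium is a theorem.

References: H. Spohn, *Large Scale Dynamics of Interacting Particles* (1991), Part I §2.3, §3.2–3.3;
J. Březina, E. Feireisl, arXiv:1702.04870, Def. 2.9.
-/

noncomputable section

namespace Summit.AtomisticToContinuum.HydrodynamicLimit.Theorems
namespace FluxClosureEq.E8

open scoped BigOperators Topology Classical MeasureTheory ProbabilityTheory InnerProductSpace ENNReal
open Filter Set Function MeasureTheory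
open Literature.MathematicalPhysics.KineticTheory Literature.Analysis.FluidPDE Literature.Analysis.FunctionSpaces
open Summit.AtomisticToContinuum.HydrodynamicLimit.Theses.BoxDissipativeWeakStrong
open Summit.AtomisticToContinuum.HydrodynamicLimit.Theorems.EntropyClockDock (ae_mem_good_localGibbsLaw)

variable {n : ℕ}

/-! ### Abstract bookkeeping -/

/-- Splitting an iterated time–space Bochner integral of a three-term sum, given integrability of each piece in
`x` for every `t ∈ (0, τ]` and of each space integral in `t` on `(0, τ]`. [folklore] -/
theorem E8_split3 {f g h : ℝ → T3 → ℝ} {τ : ℝ}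
    (hf : ∀ t ∈ Ioc 0 τ, Integrable (f t)) (hg : ∀ t ∈ Ioc 0 τ, Integrable (g t))
    (hh : ∀ t ∈ Ioc 0 τ, Integrable (h t))
    (Hf : IntegrableOn (fun t => ∫ x, f t x) (Ioc 0 τ)) (Hg : IntegrableOn (fun t => ∫ x, g t x) (Ioc 0 τ))
    (Hh : IntegrableOn (fun t => ∫ x, h t x) (Ioc 0 τ)) :
    (∫ t in Ioc 0 τ, ∫ x, (f t x + g t x + h t x)) =
      (∫ t in Ioc 0 τ, ∫ x, f t x) + (∫ t in Ioc 0 τ, ∫ x, g t x) + ∫ t in Ioc 0 τ, ∫ x, h t x := by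
  have e1 : (∫ t in Ioc 0 τ, ∫ x, (f t x + g t x + h t x)) =
      ∫ t in Ioc 0 τ, ((∫ x, f t x) + (∫ x, g t x) + ∫ x, h t x) := by
    refine setIntegral_congr_fun measurableSet_Ioc fun t ht => ?_
    have hfg : Integrable (fun x => f t x + g t x) := (hf t ht).add (hg t ht)
    rw [integral_add hfg (hh t ht), integral_add (hf t ht) (hg t ht)]
  have Hfg : Integrable (fun t => (∫ x, f t x) + ∫ x, g t x) (volume.restrict (Ioc 0 τ)) := Hf.add Hg
  rw [e1, integral_add Hfg Hh, integral_add Hf Hg]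

/-- The real/`ℝ≥0∞` triangle inequality behind the assembly: if the interior integral splits as
`I_N = L_N + C_N + P_N`, the constant-field one as `I₀ = L₀ + C₀ + P₀`, and the constant-field defect vanishes
(`A₀ − B₀ − I₀ = 0`), then `ofReal |A_N − B_N − I_N|` is at most the sum of the five `ofReal |·_N − ·₀|`. [folklore] -/
theorem E8_ofReal_abs_defect_le {AN A0 BN B0 IN I0 LN L0 CN C0 PN P0 : ℝ} (hN : IN = LN + CN + PN)
    (h0 : I0 = L0 + C0 + P0) (hE : A0 - B0 - I0 = 0) :
    ENNReal.ofReal |AN - BN - IN| ≤ ENNReal.ofReal |LN - L0| + ENNReal.ofReal |AN - A0| +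
      ENNReal.ofReal |BN - B0| + ENNReal.ofReal |CN - C0| + ENNReal.ofReal |PN - P0| := by
  have hid : AN - BN - IN = -(LN - L0) + (AN - A0) - (BN - B0) - (CN - C0) - (PN - P0) := by linarith
  have hreal : |AN - BN - IN| ≤ |LN - L0| + |AN - A0| + |BN - B0| + |CN - C0| + |PN - P0| := by
    rw [hid]
    calc |-(LN - L0) + (AN - A0) - (BN - B0) - (CN - C0) - (PN - P0)|
        ≤ |-(LN - L0) + (AN - A0) - (BN - B0) - (CN - C0)| + |PN - P0| := abs_sub _ _
      _ ≤ |-(LN - L0) + (AN - A0) - (BN - B0)| + |CN - C0| + |PN - P0| :=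
          add_le_add (abs_sub _ _) le_rfl
      _ ≤ |-(LN - L0) + (AN - A0)| + |BN - B0| + |CN - C0| + |PN - P0| :=
          add_le_add (add_le_add (abs_sub _ _) le_rfl) le_rfl
      _ ≤ |-(LN - L0)| + |AN - A0| + |BN - B0| + |CN - C0| + |PN - P0| :=
          add_le_add (add_le_add (add_le_add (abs_add_le _ _) le_rfl) le_rfl) le_rfl
      _ = |LN - L0| + |AN - A0| + |BN - B0| + |CN - C0| + |PN - P0| := by rw [abs_neg]
  calc ENNReal.ofReal |AN - BN - IN|
      ≤ ENNReal.ofReal (|LN - L0| + |AN - A0| + |BN - B0| + |CN - C0| + |PN - P0|) :=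
        ENNReal.ofReal_le_ofReal hreal
    _ ≤ ENNReal.ofReal (|LN - L0| + |AN - A0| + |BN - B0| + |CN - C0|) + ENNReal.ofReal |PN - P0| :=
        ENNReal.ofReal_add_le
    _ ≤ ENNReal.ofReal (|LN - L0| + |AN - A0| + |BN - B0|) + ENNReal.ofReal |CN - C0| +
          ENNReal.ofReal |PN - P0| := add_le_add ENNReal.ofReal_add_le le_rfl
    _ ≤ ENNReal.ofReal (|LN - L0| + |AN - A0|) + ENNReal.ofReal |BN - B0| + ENNReal.ofReal |CN - C0| +
          ENNReal.ofReal |PN - P0| := add_le_add (add_le_add ENNReal.ofReal_add_le le_rfl) le_rfl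
    _ ≤ _ := add_le_add (add_le_add (add_le_add ENNReal.ofReal_add_le le_rfl) le_rfl) le_rfl

/-! ### Constant-field pieces: the convective and pressure slices integrate to zero -/

/-- `∫ Σᵢⱼ (mᵢmⱼ/r) ∂ⱼwᵢ(t, ·) = 0` on the torus for `t` in the slab. [folklore] -/
theorem E8_integral_conv_const {T : ℝ} (r : ℝ) (m : V3) {w : ℝ → T3 → V3}
    (hw : Torus.IsSmoothSpaceTimeOn (Ico 0 T) w) {t : ℝ} (ht : t ∈ Ico 0 T) :
    (∫ x, ∑ i, ∑ j, m i * m j / r * Torus.partialDeriv j (fun y => w t y i) x) = 0 := by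
  have hwt : Torus.IsSmooth (w t) := hw.isSmooth_slice ht
  have hBij : ∀ i j : Fin 3,
      Integrable (fun x => m i * m j / r * Torus.partialDeriv j (fun y => w t y i) x) :=
    fun i j => ((hwt.apply i).partialDeriv j).integrable.const_mul _
  have hBi : ∀ i : Fin 3,
      Integrable (fun x => ∑ j, m i * m j / r * Torus.partialDeriv j (fun y => w t y i) x) :=
    fun i => integrable_finsetSum _ fun j _ => hBij i j
  rw [integral_finsetSum _ fun i _ => hBi i]
  refine Finset.sum_eq_zero fun i _ => ?_
  rw [integral_finsetSum _ fun j _ => hBij i j]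
  refine Finset.sum_eq_zero fun j _ => ?_
  rw [integral_const_mul, Torus.integral_partialDeriv_eq_zero_holds (hwt.apply i) j, mul_zero]

/-- `∫ p · div w(t, ·) = 0` on the torus for `t` in the slab. [folklore] -/
theorem E8_integral_pres_const {T : ℝ} (p : ℝ) {w : ℝ → T3 → V3}
    (hw : Torus.IsSmoothSpaceTimeOn (Ico 0 T) w) {t : ℝ} (ht : t ∈ Ico 0 T) :
    (∫ x, p * Torus.divergence (w t) x) = 0 := by
  rw [integral_const_mul, Torus.integral_divergence_eq_zero_holds (hw.isSmooth_slice ht), mul_zero]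

/-! ### Measurability of the boundary pairings in the datum -/

/-- For a hard-sphere flow `Ψ`, a time `t`, a jointly measurable kernel `k` and a measurable test field `φ`, the
pairing `z ↦ ∫ ⟪m̂(Ψ_t z)(x), φ(x)⟫ dx` is measurable. [folklore] -/
theorem E8_measurable_pairing {ε : ℝ} (Ψ : HardSphereFlow (Torus.geometry (Fin 3)) ε n) (t : ℝ)
    {k : T3 → T3 → ℝ} (hk : Measurable fun p : T3 × T3 => k p.1 p.2) {φ : T3 → V3} (hφ : Measurable φ) :
    Measurable fun z : Config n (Fin 3) T3 => ∫ x, inner ℝ (empiricalMomentumField (Ψ.flow t z) (k x)) (φ x) := by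
  have h : Measurable fun p : Config n (Fin 3) T3 × T3 =>
      inner ℝ (empiricalMomentumField (Ψ.flow t p.1) (k p.2)) (φ p.2) :=
    ((FluxClosureB5.measurable_momentum (n := n) (K := k) hk).comp
      (((Ψ.measurable_flow t).comp measurable_fst).prodMk measurable_snd)).inner (hφ.comp measurable_snd)
  exact (h.stronglyMeasurable.integral_prod_right' (ν := volume)).measurable

/-! ### A.e.-measurability of the convective and pressure time–space integrals (abstract kernel) -/

/-- The convective time–space integral `z ↦ ∫_{(0,τ]} ∫ Σᵢⱼ (m̂ᵢm̂ⱼ/ρ̂)(Ψ_t z, x) ∂ⱼwᵢ(t, x)` is a.e.-measurable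
for a law carried by the good set (`E8_aemeasurable_tsIntegral` with the clamped test factor). [folklore] -/
theorem E8_aemeasurable_conv {ε : ℝ} (Ψ : HardSphereFlow (Torus.geometry (Fin 3)) ε n)
    {k : T3 → T3 → ℝ} (hk : Measurable fun p : T3 × T3 => k p.1 p.2) {T τ : ℝ} (hτ : τ ∈ Ico 0 T)
    {w : ℝ → T3 → V3} (hw : Torus.IsSmoothSpaceTimeOn (Ico 0 T) w)
    {μ : Measure (Config n (Fin 3) T3)} (hμ : μ Ψ.goodᶜ = 0) :
    AEMeasurable (fun z : Config n (Fin 3) T3 => ∫ t in Ioc 0 τ, ∫ x, ∑ i, ∑ j,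
      empiricalMomentumField (Ψ.flow t z) (k x) i * empiricalMomentumField (Ψ.flow t z) (k x) j /
        empiricalDensityField (Ψ.flow t z) (k x) * Torus.partialDeriv j (fun y => w t y i) x) μ := by
  obtain ⟨ρc, hρc, hρS, hρeq⟩ := FluxClosureB5.exists_clamp hτ
  -- opaque names for the jointly measurable box fields (keeps higher-order unification cheap)
  obtain ⟨Mf, hMf⟩ : ∃ Mf : Config n (Fin 3) T3 × T3 → V3, Mf = fun p => empiricalMomentumField p.1 (k p.2) :=
    ⟨_, rfl⟩
  obtain ⟨Df, hDf⟩ : ∃ Df : Config n (Fin 3) T3 × T3 → ℝ, Df = fun p => empiricalDensityField p.1 (k p.2) :=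
    ⟨_, rfl⟩
  obtain ⟨Bf, hBf⟩ : ∃ Bf : Fin 3 → Fin 3 → ℝ × T3 → ℝ,
      Bf = fun i j q => Torus.partialDeriv j (fun y => w (ρc q.1) y i) q.2 := ⟨_, rfl⟩
  have mM : Measurable Mf := hMf ▸ FluxClosureB5.measurable_momentum (n := n) (K := k) hk
  have mD : Measurable Df := hDf ▸ FluxClosureB5.measurable_density (n := n) (K := k) hk
  have mB : ∀ i j, Measurable (Bf i j) := fun i j =>
    hBf ▸ FluxClosureB5.measurable_partialDeriv_comp_clamp hw (uniqueDiffOn_Ico 0 T) hρc hρS i j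
  have hπ : Measurable fun q : (ℝ × Config n (Fin 3) T3) × T3 => (q.1.2, q.2) :=
    measurable_fst.snd.prodMk measurable_snd
  have hπ' : Measurable fun q : (ℝ × Config n (Fin 3) T3) × T3 => (q.1.1, q.2) :=
    measurable_fst.fst.prodMk measurable_snd
  have mMi : ∀ i, Measurable fun q : (ℝ × Config n (Fin 3) T3) × T3 => Mf (q.1.2, q.2) i := fun i =>
    (show Measurable fun v : V3 => v i by fun_prop).comp (mM.comp hπ)
  have hF : Measurable fun q : (ℝ × Config n (Fin 3) T3) × T3 =>
      ∑ i, ∑ j, Mf (q.1.2, q.2) i * Mf (q.1.2, q.2) j / Df (q.1.2, q.2) * Bf i j (q.1.1, q.2) :=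
    Finset.measurable_sum _ fun i _ => Finset.measurable_sum _ fun j _ =>
      (((mMi i).mul (mMi j)).div (mD.comp hπ)).mul ((mB i j).comp hπ')
  refine E8_aemeasurable_tsIntegral Ψ
    (f := fun t c x => ∑ i, ∑ j, empiricalMomentumField c (k x) i * empiricalMomentumField c (k x) j /
      empiricalDensityField c (k x) * Torus.partialDeriv j (fun y => w t y i) x)
    hF (τ := τ) (fun t ht c x => ?_) hμ
  simp only [hMf, hDf, hBf, hρeq t ht]

/-- The cut-pressure time–space integral `z ↦ ∫_{(0,τ]} ∫ (ρ̂θ̂ Z(min(ρ̂σ³, η₁)))(Ψ_t z, x) div w(t, x)` is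
a.e.-measurable for a law carried by the good set. [folklore] -/
theorem E8_aemeasurable_pres {ε : ℝ} (Ψ : HardSphereFlow (Torus.geometry (Fin 3)) ε n)
    {k : T3 → T3 → ℝ} (hk : Measurable fun p : T3 × T3 => k p.1 p.2) {T τ : ℝ} (hτ : τ ∈ Ico 0 T)
    {w : ℝ → T3 → V3} (hw : Torus.IsSmoothSpaceTimeOn (Ico 0 T) w)
    {μ : Measure (Config n (Fin 3) T3)} (hμ : μ Ψ.goodᶜ = 0) (σ η₁ : ℝ) :
    AEMeasurable (fun z : Config n (Fin 3) T3 => ∫ t in Ioc 0 τ, ∫ x,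
      empiricalDensityField (Ψ.flow t z) (k x) *
        (2 / 3 * (empiricalEnergyField (Ψ.flow t z) (k x) / empiricalDensityField (Ψ.flow t z) (k x) -
          ‖empiricalMomentumField (Ψ.flow t z) (k x)‖ ^ 2 / (2 * empiricalDensityField (Ψ.flow t z) (k x) ^ 2))) *
        hsCompressibility (min (empiricalDensityField (Ψ.flow t z) (k x) * σ ^ 3) η₁) *
        Torus.divergence (w t) x) μ := by
  obtain ⟨ρc, hρc, hρS, hρeq⟩ := FluxClosureB5.exists_clamp hτ
  obtain ⟨Mf, hMf⟩ : ∃ Mf : Config n (Fin 3) T3 × T3 → V3, Mf = fun p => empiricalMomentumField p.1 (k p.2) :=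
    ⟨_, rfl⟩
  obtain ⟨Df, hDf⟩ : ∃ Df : Config n (Fin 3) T3 × T3 → ℝ, Df = fun p => empiricalDensityField p.1 (k p.2) :=
    ⟨_, rfl⟩
  obtain ⟨Ef, hEf⟩ : ∃ Ef : Config n (Fin 3) T3 × T3 → ℝ, Ef = fun p => empiricalEnergyField p.1 (k p.2) :=
    ⟨_, rfl⟩
  obtain ⟨Bf, hBf⟩ : ∃ Bf : Fin 3 → Fin 3 → ℝ × T3 → ℝ,
      Bf = fun i j q => Torus.partialDeriv j (fun y => w (ρc q.1) y i) q.2 := ⟨_, rfl⟩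
  have mM : Measurable Mf := hMf ▸ FluxClosureB5.measurable_momentum (n := n) (K := k) hk
  have mD : Measurable Df := hDf ▸ FluxClosureB5.measurable_density (n := n) (K := k) hk
  have mE : Measurable Ef := hEf ▸ FluxClosureB5.measurable_energy (n := n) (K := k) hk
  have mB : ∀ i j, Measurable (Bf i j) := fun i j =>
    hBf ▸ FluxClosureB5.measurable_partialDeriv_comp_clamp hw (uniqueDiffOn_Ico 0 T) hρc hρS i j
  have mhs : Measurable hsCompressibility := measurable_const.add (measurable_id.mul (measurable_deriv _))
  have hπ : Measurable fun q : (ℝ × Config n (Fin 3) T3) × T3 => (q.1.2, q.2) :=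
    measurable_fst.snd.prodMk measurable_snd
  have hπ' : Measurable fun q : (ℝ × Config n (Fin 3) T3) × T3 => (q.1.1, q.2) :=
    measurable_fst.fst.prodMk measurable_snd
  have mD' := mD.comp hπ
  have mE' := mE.comp hπ
  have mM' := mM.comp hπ
  have hF : Measurable fun q : (ℝ × Config n (Fin 3) T3) × T3 =>
      Df (q.1.2, q.2) * (2 / 3 * (Ef (q.1.2, q.2) / Df (q.1.2, q.2) -
        ‖Mf (q.1.2, q.2)‖ ^ 2 / (2 * Df (q.1.2, q.2) ^ 2))) *
        hsCompressibility (min (Df (q.1.2, q.2) * σ ^ 3) η₁) * ∑ i, Bf i i (q.1.1, q.2) :=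
    ((mD'.mul (((mE'.div mD').sub ((mM'.norm.pow_const 2).div ((mD'.pow_const 2).const_mul 2))).const_mul _)).mul
      (mhs.comp ((mD'.mul_const _).min measurable_const))).mul (Finset.measurable_sum _ fun i _ => (mB i i).comp hπ')
  refine E8_aemeasurable_tsIntegral Ψ
    (f := fun t c x => empiricalDensityField c (k x) *
        (2 / 3 * (empiricalEnergyField c (k x) / empiricalDensityField c (k x) -
          ‖empiricalMomentumField c (k x)‖ ^ 2 / (2 * empiricalDensityField c (k x) ^ 2))) *
        hsCompressibility (min (empiricalDensityField c (k x) * σ ^ 3) η₁) * Torus.divergence (w t) x)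
    hF (τ := τ) (fun t ht c x => ?_) hμ
  simp only [hMf, hDf, hEf, hBf, Torus.divergence, hρeq t ht]

/-- The five-term `L¹(μ)` triangle inequality for `∫⁻`: an a.e. pointwise bound by a sum of five functions, four
of them a.e.-measurable, integrates (`lintegral_add_right'`). [folklore] -/
theorem E8_lintegral_le5 {α : Type*} [MeasurableSpace α] {μ : Measure α} {D fL fA fB fC fP : α → ℝ≥0∞}
    (hA : AEMeasurable fA μ) (hB : AEMeasurable fB μ) (hC : AEMeasurable fC μ) (hP : AEMeasurable fP μ)
    (h : ∀ᵐ z ∂μ, D z ≤ fL z + fA z + fB z + fC z + fP z) :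
    ∫⁻ z, D z ∂μ ≤ (∫⁻ z, fL z ∂μ) + (∫⁻ z, fA z ∂μ) + (∫⁻ z, fB z ∂μ) + (∫⁻ z, fC z ∂μ) + ∫⁻ z, fP z ∂μ := by
  calc ∫⁻ z, D z ∂μ ≤ ∫⁻ z, fL z + fA z + fB z + fC z + fP z ∂μ := lintegral_mono_ae h
    _ = (∫⁻ z, fL z ∂μ) + (∫⁻ z, fA z ∂μ) + (∫⁻ z, fB z ∂μ) + (∫⁻ z, fC z ∂μ) + ∫⁻ z, fP z ∂μ := by
        rw [lintegral_add_right' _ hP, lintegral_add_right' _ hC, lintegral_add_right' _ hB,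
          lintegral_add_right' _ hA]

/-! ### The theorem -/

set_option maxHeartbeats 1600000 in
/-- **`FluxClosure` in global equilibrium (rung 0 of the crux; registered sub-goal E8).** Given the hard-sphere
EOS fact, there is `η_c > 0` such that for every band `0 < η₁ < η_c`, all CONSTANT profiles `a, θ > 0`, `u`,
there is `σ₀ > 0` such that for all `0 < σ < σ₀`, every horizon `T`, EVERY hard-sphere flow family `Φ` and
every kinetic window `ℓ_N` (`0 < ℓ_N ≤ 1`, `ℓ_N → 0`, `(N+1)ℓ_N³ → ∞`), for `τ ∈ [0,T)` and every `w` smooth on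
`[0,T) × 𝕋³`, the pathwise momentum-balance defect of the box fields (verbatim the crux's functional: cube
kernel, `θ̂ = ⅔(Ê/ρ̂ − |m̂|²/2ρ̂²)`, `p_cut = ρ̂θ̂ Z(min(ρ̂σ³, η₁))`) tends to `0` in `L¹` of the homogeneous local
Gibbs law `localGibbsLaw σ a u θ`. Proof: module docstring. -/
theorem fluxClosure_homogeneous : HsEosLowDensity → ∃ ηc : ℝ, 0 < ηc ∧ ∀ η₁ : ℝ, 0 < η₁ → η₁ < ηc → ∀ (a θ : ℝ) (u : V3), 0 < a → 0 < θ → ∃ σ₀ : ℝ, 0 < σ₀ ∧ ∀ σ : ℝ, 0 < σ → σ < σ₀ → ∀ (T : ℝ) (Φ : (N : ℕ) → HardSphereFlow (Torus.geometry (Fin 3)) (hsDiameter σ N) (N + 1)) (ℓ : ℕ → ℝ), (∀ N, 0 < ℓ N ∧ ℓ N ≤ 1) → Tendsto ℓ atTop (𝓝 0) → Tendsto (fun N : ℕ => ℓ N ^ 3 * ((N : ℝ) + 1)) atTop atTop → let K := fun (l : ℝ) (x y : T3) => indicator {y' : T3 | ∀ i, ‖y' i - x i‖ < l / 2} (fun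 _ => (l ^ 3)⁻¹) y; let Dn := fun N t z x => empiricalDensityField ((Φ N).flow t z) (K (ℓ N) x); let Mm := fun N t z x => empiricalMomentumField ((Φ N).flow t z) (K (ℓ N) x); let En := fun N t z x => empiricalEnergyField ((Φ N).flow t z) (K (ℓ N) x); let Th := fun (r : ℝ) (m : V3) (E : ℝ) => 2 / 3 * (E / r - ‖m‖ ^ 2 / (2 * r ^ 2)); let Zc := fun η : ℝ => hsCompressibility (min η η₁); let Pc := fun r ϑ : ℝ => r * ϑ * Zc (r * σ ^ 3); ∀ τ ∈ Ico 0 T, ∀ w : ℝ → T3 → V3, Torus.IsSmoothSpaceTimeOn (Ico 0 T) w → Tendsto (fun N : ℕ => ∫⁻ z, ENNReal.ofReal (|(∫ x, inner ℝ (Mm N τ z x) (w τ x)) - (∫ x, inner ℝ (Mm N 0 z x) (w 0 x)) - ∫ t in Ioc 0 τ, ∫ x, (inner ℝ (Mm N t z x) (Torus.timeDerivWithin (Ico 0 T) w t x) + (∑ i, ∑ j, Mm N t z x i * Mm N t z x j / Dn N t z x * Torus.partialDeriv j (fun y => w t y i) x) + Pc (Dn N t z x) (Th (Dn N t z x) (Mm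 N t z x) (En N t z x)) * Torus.divergence (w t) x)|) ∂(localGibbsLaw σ (fun _ => a) (fun _ => u) (fun _ => θ) N (Φ N))) atTop (𝓝 0) := by
  intro _hEos
  obtain ⟨ηc, hηc, hZc⟩ := HemisphereAffineSlaving.hsCompressibility_continuousOn
  refine ⟨ηc, hηc, ?_⟩
  intro η₁ hη₁ hη₁c a θ u ha hθ
  obtain ⟨σ₁, hσ₁, H1⟩ := FluxClosureEq.E1.homogeneous_fineScale_allTimes a θ u ha hθ
  refine ⟨σ₁, hσ₁, ?_⟩
  intro σ hσ hσ₁' T Φ ℓ hℓ hℓ0 hℓ3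
  obtain ⟨c₀, hc₀, H1'⟩ := H1 σ hσ hσ₁'
  have hfs := H1' Φ ℓ hℓ hℓ0 hℓ3
  dsimp only at hfs ⊢
  obtain ⟨δ, hδ, hbd⟩ := hfs
  intro τ hτ w hw
  have hU : UniqueDiffOn ℝ (Ico (0 : ℝ) T) := uniqueDiffOn_Ico 0 T
  have h0T : (0 : ℝ) ∈ Ico 0 T := ⟨le_rfl, hτ.1.trans_lt hτ.2⟩
  have hZ1 : ContinuousOn hsCompressibility (Icc 0 η₁) := hZc.mono (Icc_subset_Icc le_rfl hη₁c.le)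
  -- the five null sequences
  have h3 := FluxClosureEq.E3.homogeneous_linearTerms σ a θ c₀ T u Φ ℓ hℓ
  dsimp only at h3
  obtain ⟨hA, hB, hL⟩ := h3 δ hδ (fun N t => (hbd N t).2.1) τ hτ w hw
  have h4 := FluxClosureEq.E4.homogeneous_convectiveTerm σ a θ c₀ T u Φ ℓ hℓ hc₀
  dsimp only at h4
  have hCv := h4 δ hδ hbd τ hτ w hw
  have h5 := FluxClosureEq.E5.homogeneous_pressureTerm σ a θ c₀ η₁ T u Φ ℓ hℓ hσ.le hc₀ hη₁.le hZ1
  dsimp only at h5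
  have hPr := h5 δ hδ hbd τ hτ w hw
  -- the constant-field defect vanishes
  have h2 := FluxClosureEq.E2.homogeneous_limitDefect_eq_zero T c₀
    (c₀ * (2 / 3 * (totalEnergyDensity c₀ u θ / c₀ - ‖c₀ • u‖ ^ 2 / (2 * c₀ ^ 2))) *
      hsCompressibility (min (c₀ * σ ^ 3) η₁)) (c₀ • u) w hw τ hτ
  -- the sum of the five null sequences
  have hsum := (((hL.add hA).add hB).add hCv).add hPr
  simp only [add_zero] at hsum
  refine tendsto_of_tendsto_of_tendsto_of_le_of_le tendsto_const_nhds hsum (fun N => zero_le) fun N => ?_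
  -- FIX `N`: kernel facts, the law is carried by the good set
  have hk : Measurable fun p : T3 × T3 => {y' : T3 | ∀ i, ‖y' i - p.1 i‖ < ℓ N / 2}.indicator (fun _ => (ℓ N ^ 3)⁻¹) p.2 :=
    LGFS.measurable_boxK_uncurry (ℓ N)
  have hPgood : localGibbsLaw σ (fun _ => a) (fun _ => u) (fun _ => θ) N (Φ N) (Φ N).goodᶜ = 0 := by
    have hac : localGibbsLaw σ (fun _ => a) (fun _ => u) (fun _ => θ) N (Φ N) ≪
        liouville (Torus.geometry (Fin 3)) (N + 1) (hsDiameter σ N) := by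
      rw [localGibbsLaw, particleLaw_eq]
      exact withDensity_absolutelyContinuous _ _
    exact hac (Φ N).measure_compl_good
  -- the `L¹(P_N)` triangle inequality for `∫⁻`
  refine E8_lintegral_le5 ?_ ?_ ?_ ?_ ?_
  · exact (continuous_abs.measurable.comp ((E8_measurable_pairing (Φ N) τ hk
      (hw.isSmooth_slice hτ).continuous.measurable).sub measurable_const)).ennreal_ofReal.aemeasurable
  · exact (continuous_abs.measurable.comp ((E8_measurable_pairing (Φ N) 0 hk
      (hw.isSmooth_slice h0T).continuous.measurable).sub measurable_const)).ennreal_ofReal.aemeasurable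
  · exact (continuous_abs.measurable.comp_aemeasurable
      ((E8_aemeasurable_conv (Φ N) hk hτ hw hPgood).sub aemeasurable_const)).ennreal_ofReal
  · exact (continuous_abs.measurable.comp_aemeasurable
      ((E8_aemeasurable_pres (Φ N) hk hτ hw hPgood σ η₁).sub aemeasurable_const)).ennreal_ofReal
  -- pointwise on the good set: split both interior integrals and subtract the vanishing constant-field defect
  filter_upwards [ae_mem_good_localGibbsLaw σ (fun _ => a) (fun _ => θ) (fun _ => u) N (Φ N)] with z hz
  have hγ : Measurable fun t : ℝ => (Φ N).flow t z :=
    (Φ N).measurable_flow_prod_torus.comp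
      ((measurable_const (a := (⟨z, hz⟩ : (Φ N).good))).prodMk measurable_id)
  obtain ⟨iL, iC, iP, xL, xC, xP⟩ := E8_orbit_integrable (γ := fun t => (Φ N).flow t z)
    (k := fun x y => {y' : T3 | ∀ i, ‖y' i - x i‖ < ℓ N / 2}.indicator (fun _ => (ℓ N ^ 3)⁻¹) y)
    hγ (Real.sqrt_nonneg _) (fun t i => FluxClosureB4.norm_vel_flow_le (Φ N) hz t i) hk
    (fun x y => LGFS.boxK_nonneg (hℓ N).1.le x y) (fun x y => LGFS.boxK_le (hℓ N).1.le x y)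
    (fun x y => by simp only [Set.indicator]; split_ifs <;> simp) hτ hw σ η₁
  have hIoc : ∀ t ∈ Ioc 0 τ, t ∈ Ico 0 T := fun t ht => ⟨ht.1.le, lt_of_le_of_lt ht.2 hτ.2⟩
  refine E8_ofReal_abs_defect_le (E8_split3 xL xC xP iL iC iP) (E8_split3 ?_ ?_ ?_ ?_ ?_ ?_) h2
  · intro t ht
    exact (((hw.timeDerivWithin hU).isSmooth_slice (hIoc t ht)).integrable.const_inner _)
  · intro t ht
    have hwt : Torus.IsSmooth (w t) := hw.isSmooth_slice (hIoc t ht)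
    exact integrable_finsetSum _ fun i _ => integrable_finsetSum _ fun j _ =>
      ((hwt.apply i).partialDeriv j).integrable.const_mul _
  · intro t ht
    exact (hw.isSmooth_slice (hIoc t ht)).divergence.integrable.const_mul _
  · exact FluxClosureEq.E3.e3_integrableOn_pairing hτ.2 hw (M := fun _ _ => c₀ • u) measurable_const
      (fun _ _ => le_rfl)
  · exact integrableOn_zero.congr_fun (fun t ht => (E8_integral_conv_const c₀ (c₀ • u) hw (hIoc t ht)).symm)
      measurableSet_Ioc
  · exact integrableOn_zero.congr_fun (fun t ht => (E8_integral_pres_const _ hw (hIoc t ht)).symm)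
      measurableSet_Ioc

end FluxClosureEq.E8
end Summit.AtomisticToContinuum.HydrodynamicLimit.Theorems

end
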